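import Mathlib
import Summits.ABC.ABC.Theorems.RibetTakahashiSplitManyPrimeValuationProductStubFermatInputKnownFrey
import Literature.NumberTheory.DiophantineGeometry.GeneralizedFermatTwoPowerCoefficient

/-!
# The Fermat input of Pasten's cokernel bound where it is known, III: the generalized-Fermat
# input as named facts

Sequel of `…StubFermatInputKnown` (p80751) and `…StubFermatInputKnownFrey` (p82851) (helpers
`--supports` stmt-ABC-1561, stub `stub_fermatInputKnown : FermatInputKnown` of the line
`jl-zero-cycle-height` for the crux
`Summit.ABC.ABC.Theses.RibetTakahashiSplit.ManyPrimeValuationProduct`). There the stub was closed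
modulo two inputs: (A) the `ℓ`-th power exclusion for semistable curves, taken from the tree's named
fact `Literature.NumberTheory.EllipticCurves.mestreOesterle1989_thm_1`, and (B) the
generalized-Fermat input `hFermat`: for a prime `ℓ ≥ 11`, every solution of
`x ^ ℓ + 2 ^ m y ^ ℓ + z ^ ℓ = 0`, `0 ≤ m < ℓ`, in pairwise coprime integers with `x, z` odd has
`|xyz| ≤ 1`. Here (B) is made a consequence of NAMED published facts:

* `m = 0`: Fermat's Last Theorem — Mathlib's `FermatLastTheorem` (Wiles, Taylor–Wiles), taken as a
  hypothesis, not restated;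
* `2 ≤ m < ℓ`: K. Ribet, *On the equation `a^p + 2^α b^p + c^p = 0`*, Acta Arith. 79 (1997) —
  the named fact `ribet1997_twoPowerFermat`;
* `m = 1`: H. Darmon, L. Merel, *Winding quotients and some variants of Fermat's Last Theorem*,
  J. reine angew. Math. 490 (1997) (Dénes' equation `x^p + y^p = 2 z^p`) — the named fact
  `darmonMerel1997_denesEquation`;

both stated in the printed form of the held secondary source H. Cohen, *Number Theory II*
(GTM 240, 2007), Thm 15.3.1 (chapter 15 by S. Siksek), which is exactly the trichotomy used in
H. Pasten, *Shimura curves and the abc conjecture*, arXiv:1705.09251, proof of Lemma 6.12.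

Results: `genFermat_two_power_trivial` ((B) from the three facts, by the case split on `m`) and
`fermatInputKnown_of_namedFacts` = the skeleton's `FermatInputKnown` (abbreviations unfolded)
conditional on exactly four named facts (`mestreOesterle1989_thm_1`, `FermatLastTheorem`,
`ribet1997_twoPowerFermat`, `darmonMerel1997_denesEquation`), so that `stub_fermatInputKnown`
is CLOSED MODULO NAMED FACTS: it is `fermatInputKnown_of_namedFacts hMO hFLT hR hDM` by
`rfl`-unfolding.
-/

-- `Summit.ABC.ABC` is the mandated summit-side namespace (CONVENTIONS §2); the duplicate is deliberate.
set_option linter.dupNamespace false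

namespace Summit.ABC.ABC.Theorems.ManyPrimeValuationProduct

/-- **The generalized-Fermat input of Pasten's Lemma 6.12 from the three named facts.** For a
prime `ℓ ≥ 11` (any prime `ℓ ≥ 5` would do), every solution of `x ^ ℓ + 2 ^ m y ^ ℓ + z ^ ℓ = 0`
with `m < ℓ` in pairwise coprime integers (with `x, z` odd — not needed) has `|xyz| ≤ 1`: if
`xyz = 0` there is nothing to prove; otherwise `m = 0` contradicts Fermat's Last Theorem at the
exponent `ℓ` (`x ^ ℓ + y ^ ℓ = (−z) ^ ℓ`, `ℓ` odd; Mathlib's `FermatLastTheorem` over `ℤ` via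
`fermatLastTheoremFor_iff_int`), `2 ≤ m < ℓ` contradicts `ribet1997_twoPowerFermat`, and for
`m = 1` `darmonMerel1997_denesEquation` gives `(x, y, z) = ±(1, −1, 1)`, so `|xyz| = 1`
(H. Pasten, arXiv:1705.09251, proof of Lemma 6.12; H. Cohen, GTM 240, Thm 15.3.1). `[folklore]` -/
theorem genFermat_two_power_trivial :
    FermatLastTheorem → Literature.NumberTheory.DiophantineGeometry.ribet1997_twoPowerFermat → Literature.NumberTheory.DiophantineGeometry.darmonMerel1997_denesEquation →
      ∀ ℓ : ℕ, ℓ.Prime → 11 ≤ ℓ → ∀ (x y z : ℤ) (m : ℕ), m < ℓ → IsCoprime x y → IsCoprime x z →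
        IsCoprime y z → Odd x → Odd z → x ^ ℓ + 2 ^ m * y ^ ℓ + z ^ ℓ = 0 →
        (x * y * z).natAbs ≤ 1 := by
  intro hFLT hR hDM ℓ hℓ h11 x y z m hm hxy hxz hyz _hx _hz heq
  by_cases h0 : x * y * z = 0
  · simp [h0]
  have hx0 : x ≠ 0 := fun h => h0 (by rw [h, zero_mul, zero_mul])
  have hy0 : y ≠ 0 := fun h => h0 (by rw [h, mul_zero, zero_mul])
  have hz0 : z ≠ 0 := fun h => h0 (by rw [h, mul_zero])
  have h5 : 5 ≤ ℓ := le_trans (by norm_num) h11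
  rcases Nat.lt_or_ge m 2 with hm2 | hm2
  · interval_cases m
    · -- `m = 0`: Fermat's Last Theorem at the odd exponent `ℓ ≥ 3`
      exfalso
      have hodd : Odd ℓ := hℓ.odd_of_ne_two (by omega)
      refine fermatLastTheoremFor_iff_int.mp (hFLT ℓ (by omega)) x y (-z) hx0 hy0
        (neg_ne_zero.mpr hz0) ?_
      rw [hodd.neg_pow]
      linear_combination heq
    · -- `m = 1`: Darmon–Merel
      rcases hDM ℓ hℓ h5 x y z h0 hxy hxz hyz (by linear_combination heq) with
        ⟨rfl, rfl, rfl⟩ | ⟨rfl, rfl, rfl⟩ <;> decide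
  · -- `2 ≤ m < ℓ`: Ribet
    exact absurd heq (hR ℓ hℓ h5 m hm2 hm x y z h0 hxy hxz hyz)

/-- **Registered sub-goal of `stub_fermatInputKnown`: `FermatInputKnown` closed modulo named
facts.** The skeleton's `FermatInputKnown` (abbreviations `multPrimes`, `IsSemistableAwayFromTwo`,
`FermatInput`, `IsSemistable`, `IsFreyIsomorphic` unfolded), conditional on exactly four NAMED
published facts: Mestre–Oesterlé 1989 Thm 1 (`mestreOesterle1989_thm_1`: input (A), the `ℓ`-th
power exclusion for semistable curves, Pasten's Lemma 6.11), Fermat's Last Theorem (Mathlib's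
`FermatLastTheorem`), Ribet 1997 (`ribet1997_twoPowerFermat`) and Darmon–Merel 1997
(`darmonMerel1997_denesEquation`) (together input (B), Pasten's Lemma 6.12). It is
`fermatInputKnown_of_mestreOesterle` fed with `genFermat_two_power_trivial`; hence
`stub_fermatInputKnown` is `fermatInputKnown_of_namedFacts hMO hFLT hR hDM` by `rfl`-unfolding
(the form registered with `ledger workitem stub-add stmt-ABC-1561 --name fermatInputKnown_of_namedFacts`).
`[folklore]` -/
theorem fermatInputKnown_of_namedFacts : Literature.NumberTheory.EllipticCurves.mestreOesterle1989_thm_1 → FermatLastTheorem → Literature.NumberTheory.DiophantineGeometry.ribet1997_twoPowerFermat → Literature.NumberTheory.DiophantineGeometry.darmonMerel1997_denesEquation → ∀ (W : WeierstrassCurve ℚ) [W.IsElliptic], (∀ p : ℕ, p.Prime → p ≠ 2 → ¬ p ^ 2 ∣ W.conductorNorm ℤ) → 4 ≤ ((W.conductorNorm ℤ).primeFactors.filter (fun p => ¬ p ^ 2 ∣ W.conductorNorm ℤ)).card → ((∀ p : ℕ, p.Prime → ¬ p ^ 2 ∣ W.conductorNorm ℤ) ∨ ∃ (a b d : ℤ)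 (C : WeierstrassCurve.VariableChange ℚ), IsCoprime a b ∧ a * b * (a + b) ≠ 0 ∧ d ∣ 2 ∧ C • W = Literature.NumberTheory.EllipticCurves.freyCurve (d * a) (d * b)) → ∀ ℓ : ℕ, ℓ.Prime → 11 ≤ ℓ → ∃ r ∈ (W.conductorNorm ℤ).primeFactors.filter (fun p => ¬ p ^ 2 ∣ W.conductorNorm ℤ), ¬ ℓ ∣ (W.minimalDiscriminantNorm ℤ).factorization r :=
  fun hMO hFLT hR hDM W _ _ h4 hAB =>
    fermatInputKnown_of_mestreOesterle hMO (genFermat_two_power_trivial hFLT hR hDM) W h4 hAB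

end Summit.ABC.ABC.Theorems.ManyPrimeValuationProduct
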